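import Literature.Barriers.FinalStateConjecture.TrappingDerivativeLossGeodesicBeamsData
import Literature.Geometry.Lorentzian.GaussianBeamBox
import Literature.Geometry.Lorentzian.KerrSchildLeafCurrents
import Literature.Geometry.Lorentzian.KerrFluxComparison
import Literature.Barriers.FinalStateConjecture.TrappingDerivativeLossOrbit
import Literature.Geometry.Lorentzian.KerrSchildWaveCauchyProblemProofs
import HarnessLib

/-!
# Gaussian beams along a null geodesic of Kerr, IV: the proof of `KerrNullGeodesicGaussianBeams`
(fourth and last proof file towards `KerrNullGeodesicGaussianBeams_holds`,
`Literature/Barriers/FinalStateConjecture/TrappingDerivativeLossGeodesicBeams.lean`; family `gr`,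
summit `FinalStateConjecture`; namespace `Literature.Barriers.FinalStateConjecture`)

Sbierski, Anal. PDE 8 (2015), Thm. 1.2/§4 (the geometric characterisation of the energy of Gaussian
beams) on the Kerr exterior, for the leaves `Σ_τ = {t* = τ}` and `N = −(dt*)♯`: given a
future-directed null geodesic `γ` with `γ⁰(0) = 0`, a neighbourhood `𝒩 ⊇ γ([0, ∞))`, a time
`T > 0` reached by `γ` and `μ > 0`, there is a `C^∞` function `u` on the exterior chart, supported
in `𝒩`, with `‖□_g u‖²_{L²(R_{[0,T]})} ≤ μ`, `E^N_0(u) = γ̇⁰(0)` and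
`|E^N_τ(u) − γ̇⁰(s)| < μ` whenever `γ⁰(s) = τ ∈ [0, T]`.

The proof assembles the files of the series: the beam data of `γ` in Kerr–Schild time
(`…GeodesicBeamsData`: `KerrNullGeodesic.beamData`), a thin admissible amplitude in a tube
inside `𝒩` (`GaussianBeamTube`: `BeamData.exists_beamAmp`, thinness `δ` chosen from `μ` and
the range of `γ̇⁰` on `[0, T]`), the characterisation of the energy of the real beam
`Re(a e^{iλφ})` (`GaussianBeamCross`: `BeamAmp.energy_characterisation'`), the slab bound for
`□_g` of the beam (`GaussianBeamBox`), and two dictionary statements proved here: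

* `Kerr.stressEnergy_timeVector_eq_normalCurrent` — `T[ψ](V, V) = P⁰[Φ]`
  (`KerrSchild.normalCurrent (Kerr.inverseMetric M a) Φ x 0`) for `ψ` represented by `Φ` on the
  chart (`Kerr.sum_multiplierCurrent_mul_eq_stressEnergy` with `n = −dt*`, `V = −g♯dt*`);
* `Kerr.leafFlux_zero_eq_ofReal_integral` — for `Φ ∈ C^∞_c` supported in the exterior,
  `Kerr.leafFlux M a 0 Φ τ = ofReal (∫ P⁰[Φ](τ, y) dy)`;
* `Kerr.slabSqNorm_le_ofReal` — the slab norm of `□_g` of such a function is at most the real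
  slab integral of `(□ Φ)²` lifted to `ℝ × E3`;

then normalises `u = √(γ̇⁰(0)/E₀) · Re(a e^{iλφ})` and takes `λ` large:
**`KerrNullGeodesicGaussianBeams_holds`**; corollary `SbierskiKerrTrappingLED.of_waveCauchyProblem`
(the barrier in the `LED` form now depends on `KerrSchild.waveCauchyProblem` only).

**Appendix (discharge of the barrier).** With `KerrSchild.waveCauchyProblem_holds`
(`Literature/Geometry/Lorentzian/KerrSchildWaveCauchyProblemProofs.lean`: John's symmetric
hyperbolic reduction and Friedrichs' existence theorem, all proved in the tree) the corollary gives
**`SbierskiKerrTrappingLED_holds`**: Sbierski's Kerr trapping theorem, Anal. PDE 8 (2015), Thm. 7.4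
in the print-literal `LED` form of `TrappingDerivativeLoss.lean`, is a theorem of the tree (axioms
`propext`, `Classical.choice`, `Quot.sound`).

## References

* J. Sbierski, Anal. PDE 8 (2015) 1379–1420 (arXiv:1311.2477v2): Thm. 1.2, §3 (Def. 3.1, second
  lemma), §4 (the theorem, its proof, third remark); arXiv §2.2–2.3 (key `Sbierski2015`).
* M. Dafermos, I. Rodnianski, arXiv:0811.0354, §5.1 and App. D (the chart, `V`, `J^V`)
  (key `DafermosRodnianski2008`).
-/

noncomputable section

open Bundle Set Filter Function MeasureTheory Complex
open scoped Manifold ContDiff Topology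

namespace Literature.Geometry.Lorentzian

namespace Kerr

open KerrSchild

variable [Facts] [SliceFacts]

/-! ### `T[ψ](V, V)` is the density `P⁰` of the `dt`-current -/

omit [Facts] [SliceFacts] in
/-- The components of `V = −g♯dt*`: `V^α = −g^{0α}`. [cite: DafermosRodnianski2008, §5.1] -/
theorem timeVector_apply_eq_neg_inverseMetric (M a : ℝ) (x : E4) (α : Fin 4) :
    timeVector M a x α = -inverseMetric M a x 0 α := by
  rw [inverseMetric_apply, nullVector_apply_zero]
  refine Fin.cases ?_ (fun i ↦ ?_) α
  · simp [timeVector, nullVector_apply_zero, E4.basisVector]; ring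
  · simp [timeVector, E4.basisVector, Fin.succ_ne_zero, (Fin.succ_ne_zero i).symm]

omit [Facts] [SliceFacts] in
/-- `g♯(−dt*) = V` wherever `r > 0` (`g(g♯p, w) = p(w)`, `g(V, w) = −w⁰`, nondegeneracy).
[cite: DafermosRodnianski2008, §5.1] -/
theorem coSharp_covector_neg_delta_zero (M a : ℝ) {x : E4} (hx : 0 < radius a x) :
    coSharp M a x (E4.covector (fun μ : Fin 4 ↦ if μ = 0 then (-1 : ℝ) else 0) : E4 →L[ℝ] ℝ) =
      timeVector M a x := by
  have hdiff : ∀ w, bilin M a x (coSharp M a x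
      (E4.covector (fun μ : Fin 4 ↦ if μ = 0 then (-1 : ℝ) else 0) : E4 →L[ℝ] ℝ) - timeVector M a x) w = 0 := by
    intro w
    rw [map_sub, sub_apply, bilin_coSharp M a hx, bilin_timeVector hx]
    simp [E4.covector_apply]
  have h := bilin_nondegenerate M a hx _ hdiff
  exact sub_eq_zero.1 h

omit [SliceFacts] in
/-- **`T[ψ](V, V) = P⁰[Φ]`**: the `V`-energy density of `ψ` (represented by `Φ` on the chart,
differentiable at `x`) is the time component of the `dt`-current `KerrSchild.normalCurrent` of the
inverse Kerr metric. [cite: DafermosRodnianski2008, App. D] -/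
theorem stressEnergy_timeVector_eq_normalCurrent (M a : ℝ) {ψ : region a (rPlus M a) → ℝ}
    {Φ : E4 → ℝ} (hψ : ∀ y, ψ y = Φ y) (x : region a (rPlus M a)) (hΦ : DifferentiableAt ℝ Φ x) :
    (smoothMetric M a (rPlus M a)).stressEnergy ψ x (timeVector M a x.1) (timeVector M a x.1) =
      normalCurrent (inverseMetric M a) Φ x 0 := by
  have h := sum_multiplierCurrent_mul_eq_stressEnergy M a (rPlus M a) hψ x hΦ
    (X := fun z α ↦ timeVector M a z α) (Y := timeVector M a x.1) (fun _ ↦ rfl)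
    (fun μ : Fin 4 ↦ if μ = 0 then (-1 : ℝ) else 0)
  rw [coSharp_covector_neg_delta_zero M a (radius_pos_of_mem_region x.2)] at h
  change _ = (smoothMetric M a (rPlus M a)).stressEnergy ψ x (timeVector M a x.1) (timeVector M a x.1) at h
  rw [← h]
  simp only [mul_ite, mul_neg, mul_one, mul_zero, Finset.sum_ite_eq', Finset.mem_univ, if_true]
  simp only [multiplierCurrent, normalCurrent, timeVector_apply_eq_neg_inverseMetric]
  simp only [neg_mul, Finset.sum_neg_distrib, mul_neg]
  ring

/-! ### The leaf energy of a compactly supported smooth function as a real integral -/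

omit [SliceFacts] in
/-- **The height-`0` flux density of a compactly supported smooth function is `P⁰`**, pointwise in
`y`. [folklore] -/
theorem leafFluxDensity_zero_eq_ofReal {M a : ℝ} {Φ : E4 → ℝ} (hΦ : ContDiff ℝ ∞ Φ)
    (hsupp : tsupport Φ ⊆ (region a (rPlus M a) : Set E4)) (τ : ℝ) (y : E3) :
    leafFluxDensity M a 0 (fun x : region a (rPlus M a) ↦ Φ x) τ y =
      ENNReal.ofReal (normalCurrent (inverseMetric M a) Φ (E4.ofTimeSpace τ y) 0) := by
  by_cases hmem : E4.ofTimeSpace τ y ∈ region a (rPlus M a)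
  · rw [leafFluxDensity_zero_height_of_mem _ τ hmem,
      stressEnergy_timeVector_eq_normalCurrent M a (fun _ ↦ rfl) ⟨_, hmem⟩
        ((hΦ.differentiable (by simp)) _)]
  · rw [leafFluxDensity_zero_height_of_not_mem _ τ hmem,
      GaussianBeam.normalCurrent_eq_zero_of_notMem_tsupport (fun h ↦ hmem (hsupp h)), ENNReal.ofReal_zero]

omit [SliceFacts] in
/-- `P⁰ ≥ 0` for a compactly supported smooth function on the exterior (`M ≥ 0`):
`T(V, V) ≥ 0`. [cite: DafermosRodnianskiShlapentokhrothman2014, §3.1] -/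
theorem normalCurrent_nonneg {M a : ℝ} (hM : 0 ≤ M) {Φ : E4 → ℝ} (hΦ : ContDiff ℝ ∞ Φ)
    (hsupp : tsupport Φ ⊆ (region a (rPlus M a) : Set E4)) (x : E4) :
    0 ≤ normalCurrent (inverseMetric M a) Φ x 0 := by
  by_cases hmem : x ∈ region a (rPlus M a)
  · rw [← stressEnergy_timeVector_eq_normalCurrent M a (ψ := fun z : region a (rPlus M a) ↦ Φ z)
      (fun _ ↦ rfl) ⟨x, hmem⟩ ((hΦ.differentiable (by simp)) _)]
    have h := coordEnergyDensity_le_four_mul_stressEnergy hM (fun z : region a (rPlus M a) ↦ Φ z) ⟨x, hmem⟩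
    have h0 := coordEnergyDensity_nonneg (region a (rPlus M a)) (fun z : region a (rPlus M a) ↦ Φ z) x
    linarith
  · rw [GaussianBeam.normalCurrent_eq_zero_of_notMem_tsupport (fun h ↦ hmem (hsupp h))]

omit [SliceFacts] in
/-- **The energy through `Σ_τ` of a compactly supported smooth function is the real integral of
`P⁰` over the leaf**: `E^N_τ = ∫ P⁰(τ, y) dy` (as `ofReal`). [cite: Sbierski2015, §4 (the theorem: `E^N_τ`)] -/
theorem leafFlux_zero_eq_ofReal_integral {M a : ℝ} (hM : 0 ≤ M) {Φ : E4 → ℝ} (hΦ : ContDiff ℝ ∞ Φ)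
    (hc : HasCompactSupport Φ) (hsupp : tsupport Φ ⊆ (region a (rPlus M a) : Set E4)) (τ : ℝ) :
    leafFlux M a 0 (fun x : region a (rPlus M a) ↦ Φ x) τ =
      ENNReal.ofReal (∫ y, normalCurrent (inverseMetric M a) Φ (E4.ofTimeSpace τ y) 0) := by
  have hfun : leafFluxDensity M a 0 (fun x : region a (rPlus M a) ↦ Φ x) τ =
      fun y ↦ ENNReal.ofReal (normalCurrent (inverseMetric M a) Φ (E4.ofTimeSpace τ y) 0) :=
    funext (leafFluxDensity_zero_eq_ofReal hΦ hsupp τ)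
  rw [leafFlux, hfun, ofReal_integral_eq_lintegral_ofReal]
  · have hG : ∀ μ ν, ContDiffOn ℝ ∞ (fun x ↦ inverseMetric M a x μ ν) (region a (rPlus M a) : Set E4) :=
      fun μ ν x hx ↦ (contDiffAt_inverseMetric M a (radius_pos_of_mem_region hx) μ ν).contDiffWithinAt
    have hcont : Continuous fun x ↦ normalCurrent (inverseMetric M a) Φ x 0 :=
      GaussianBeam.continuous_normalCurrent_of_tsupport_subset (region a (rPlus M a)).isOpen hG hΦ hsupp 0
    exact GaussianBeam.integrable_slice hcont (GaussianBeam.hasCompactSupport_normalCurrent hc 0) τ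
  · exact Eventually.of_forall fun y ↦ normalCurrent_nonneg hM hΦ hsupp _

/-! ### The slab norm of `□_g` of a compactly supported smooth function -/

omit [Facts] [SliceFacts] in
/-- **Lifting a slab integral to `ℝ × E3`**: `∫⁻_{x⁰ ∈ S} g = ∫⁻_{S × E3} g(t, y)` for measurable
`g` (`E4.timeSplit` preserves Lebesgue measure). [folklore] -/
theorem setLIntegral_timeSlab_eq_prod (g : E4 → ENNReal) {S : Set ℝ} (hS : MeasurableSet S) :
    ∫⁻ x in {x : E4 | x 0 ∈ S}, g x = ∫⁻ p in S ×ˢ (univ : Set E3), g (E4.ofTimeSpace p.1 p.2) := by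
  have hpre : (fun p : ℝ × E3 ↦ E4.timeSplit.symm p) ⁻¹' {x : E4 | x 0 ∈ S} = S ×ˢ (univ : Set E3) := by
    ext p
    simp [E4.timeSplit_symm_apply]
  have hS' : MeasurableSet {x : E4 | x 0 ∈ S} := (E4.dx 0).continuous.measurable hS
  rw [← E4.measurePreserving_timeSplit_symm.setLIntegral_comp_preimage_emb
    E4.timeSplit.symm.measurableEmbedding g {x : E4 | x 0 ∈ S}, hpre]
  simp only [E4.timeSplit_symm_apply]

/-- `□_g u = □ Φ` on the chart, for `u` represented by `Φ ∈ C^∞`. [folklore] -/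
theorem extend_dalembertian_eq_waveOperator {M a : ℝ} {Φ : E4 → ℝ} (hΦ : ContDiff ℝ ∞ Φ)
    (x : exterior M a) :
    Function.extend Subtype.val (fun x : exterior M a ↦
      (smoothMetric M a (rPlus M a)).toPseudoRiemannianMetric.dalembertian (fun z : exterior M a ↦ Φ z) x)
        (0 : E4 → ℝ) x = waveOperator (inverseMetric M a) Φ x := by
  rw [Literature.Barriers.FinalStateConjecture.extend_val_apply]
  exact dalembertian_eq_divergence M a (rPlus M a) (fun _ ↦ rfl) x
    (hΦ.contDiffAt.of_le ENat.LEInfty.out)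

omit [Facts] [SliceFacts] in
/-- The slab norm is at most the integral of the squared zero extension over the time slab
`{0 ≤ x⁰ ≤ T}` (dropping the restriction to `U`). [folklore] -/
theorem slabSqNorm_le_setLIntegral (U : TopologicalSpace.Opens E4) (F : U → ℝ) (T : ℝ) :
    Literature.Barriers.FinalStateConjecture.slabSqNorm U F T ≤
      ∫⁻ x in {x : E4 | x 0 ∈ Icc (0 : ℝ) T},
        ENNReal.ofReal (Function.extend Subtype.val F (0 : E4 → ℝ) x ^ 2) := by
  have hmeasT : MeasurableSet {x : E4 | x 0 ∈ Icc (0 : ℝ) T} :=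
    (E4.dx 0).continuous.measurable measurableSet_Icc
  rw [Literature.Barriers.FinalStateConjecture.slabSqNorm, ← lintegral_indicator hmeasT]
  refine lintegral_mono fun x ↦ ?_
  by_cases hx : x ∈ {x : E4 | x ∈ (U : Set E4) ∧ 0 ≤ x 0 ∧ x 0 ≤ T}
  · rw [Set.indicator_of_mem hx, Set.indicator_of_mem (show x ∈ {x : E4 | x 0 ∈ Icc (0 : ℝ) T}
      from ⟨hx.2.1, hx.2.2⟩)]
  · rw [Set.indicator_of_notMem hx]
    exact zero_le

/-- The squared zero extension of `□_g u` is dominated by `(□ Φ)²` everywhere. [folklore] -/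
theorem extend_dalembertian_sq_le {M a : ℝ} {Φ : E4 → ℝ} (hΦ : ContDiff ℝ ∞ Φ) (x : E4) :
    Function.extend Subtype.val (fun x : exterior M a ↦
      (smoothMetric M a (rPlus M a)).toPseudoRiemannianMetric.dalembertian (fun z : exterior M a ↦ Φ z) x)
        (0 : E4 → ℝ) x ^ 2 ≤ waveOperator (inverseMetric M a) Φ x ^ 2 := by
  by_cases hx : x ∈ (exterior M a : Set E4)
  · rw [extend_dalembertian_eq_waveOperator hΦ ⟨x, hx⟩]
  · rw [Function.extend_apply' _ _ _ (fun ⟨y, hy⟩ ↦ hx (hy ▸ y.2)), Pi.zero_apply]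
    simpa using sq_nonneg _

/-- **The slab norm of `□_g u`, for `u` represented by `Φ ∈ C^∞_c` supported in the exterior, is
at most the real slab integral of `(□ Φ)²` lifted to `ℝ × E3`** (`□_g u = □ Φ` on the chart by
`Kerr.dalembertian_eq_divergence`; Tonelli through `E4.timeSplit`). [cite: Sbierski2015, §2 (proof of Thm. 2.1, first condition)] -/
theorem slabSqNorm_dalembertian_le {M a : ℝ} {Φ : E4 → ℝ} (hΦ : ContDiff ℝ ∞ Φ)
    (hc : HasCompactSupport Φ) (hsupp : tsupport Φ ⊆ (exterior M a : Set E4)) {T B : ℝ}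
    (hB : ∫ p in Icc (0 : ℝ) T ×ˢ (univ : Set E3),
      waveOperator (inverseMetric M a) Φ (E4.ofTimeSpace p.1 p.2) ^ 2 ≤ B) :
    Literature.Barriers.FinalStateConjecture.slabSqNorm (exterior M a)
      (fun x ↦ (smoothMetric M a (rPlus M a)).toPseudoRiemannianMetric.dalembertian
        (fun z : exterior M a ↦ Φ z) x) T ≤ ENNReal.ofReal B := by
  have hG : ∀ μ ν, ContDiffOn ℝ ∞ (fun x ↦ inverseMetric M a x μ ν) (exterior M a : Set E4) :=
    fun μ ν x hx ↦ (contDiffAt_inverseMetric M a (radius_pos_of_mem_region hx) μ ν).contDiffWithinAt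
  have hwO_c : Continuous (waveOperator (inverseMetric M a) Φ) :=
    GaussianBeam.continuous_waveOperator_of_tsupport_subset (exterior M a).isOpen hG hΦ hsupp
  have hwO0 : ∀ x, x ∉ tsupport Φ → waveOperator (inverseMetric M a) Φ x = 0 := fun x hx ↦ by
    refine waveOperator_eq_zero_of_eventuallyEq_zero ?_
    filter_upwards [(isClosed_tsupport Φ).isOpen_compl.mem_nhds hx] with z hz
    exact image_eq_zero_of_notMem_tsupport hz
  have hwO_supp : HasCompactSupport (waveOperator (inverseMetric M a) Φ) :=
    IsCompact.of_isClosed_subset hc (isClosed_tsupport _)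
      (closure_minimal (fun x hx ↦ by by_contra h; exact hx (hwO0 x h)) (isClosed_tsupport _))
  have hsq_supp : HasCompactSupport fun x ↦ waveOperator (inverseMetric M a) Φ x ^ 2 :=
    IsCompact.of_isClosed_subset hwO_supp (isClosed_tsupport _)
      (closure_minimal (fun x hx ↦ by
        by_contra h
        exact hx (by simp [image_eq_zero_of_notMem_tsupport h])) (isClosed_tsupport _))
  have hsq_c : Continuous fun p : ℝ × E3 ↦ waveOperator (inverseMetric M a) Φ (E4.ofTimeSpace p.1 p.2) ^ 2 :=
    (hwO_c.pow 2).comp (GaussianBeam.contDiff_ofTimeSpace_uncurry (n := 0)).continuous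
  have hint : Integrable fun p : ℝ × E3 ↦ waveOperator (inverseMetric M a) Φ (E4.ofTimeSpace p.1 p.2) ^ 2 :=
    hsq_c.integrable_of_hasCompactSupport
      (GaussianBeam.hasCompactSupport_comp_ofTimeSpace (f := fun x ↦ waveOperator (inverseMetric M a) Φ x ^ 2)
        hsq_supp)
  refine (slabSqNorm_le_setLIntegral _ _ T).trans ?_
  refine (lintegral_mono fun x ↦ ENNReal.ofReal_le_ofReal (extend_dalembertian_sq_le hΦ x)).trans ?_
  rw [setLIntegral_timeSlab_eq_prod _ measurableSet_Icc,
    ← ofReal_integral_eq_lintegral_ofReal hint.integrableOn (Eventually.of_forall fun _ ↦ sq_nonneg _)]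
  exact ENNReal.ofReal_le_ofReal hB

end Kerr

end Literature.Geometry.Lorentzian

/-! ### The proof of `KerrNullGeodesicGaussianBeams` -/

namespace Literature.Barriers.FinalStateConjecture

open Literature.Geometry.Lorentzian Literature.Geometry.Lorentzian.GaussianBeam
  Literature.Geometry.Lorentzian.KerrSchild Literature.Analysis.Calculus GaussianBeam

namespace GaussianBeam.KerrNullGeodesic

variable [Kerr.Facts] [Kerr.SliceFacts]

variable {M a : ℝ} (Γ : KerrNullGeodesic M a)

/-- `σ` is monotone on `J`: `σ(τ) ≥ 0` for `τ ∈ J`, `τ ≥ 0`. [folklore] -/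
theorem σ_nonneg {τ : ℝ} (hτ : τ ∈ Γ.J) (h0 : 0 ≤ τ) : 0 ≤ Γ.σ τ := by
  rcases h0.lt_or_eq with h | h
  · have := StrictMonoInverse.strictMonoOn_invFun Γ.hasDerivAt_tfun Γ.time_pos Γ.zero_mem_J hτ h
    rw [show Function.invFun Γ.tfun 0 = Γ.σ 0 from rfl, Γ.σ_zero] at this
    exact this.le
  · rw [← h, Γ.σ_zero]

/-- For `τ ∈ J`, `τ ≥ 0`, the point `X(τ) = γ(σ(τ))` lies in `γ([0, ∞))`. [folklore] -/
theorem X_mem_image {τ : ℝ} (hτ : τ ∈ Γ.J) (h0 : 0 ≤ τ) : Γ.γ (Γ.σ τ) ∈ Γ.γ '' Ici 0 :=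
  ⟨Γ.σ τ, Γ.σ_nonneg hτ h0, rfl⟩

/-- If `γ⁰(s) = τ` then `s = σ(τ)` and `κ(τ) = γ̇⁰(s)`. [folklore] -/
theorem κ_eq_of_tfun_eq {s τ : ℝ} (h : (Γ.γ s : E4) 0 = τ) : Γ.κ τ = vel Γ.γ s 0 := by
  have hs : Γ.σ τ = s := by rw [← h]; exact Γ.σ_tfun s
  rw [KerrNullGeodesic.κ, hs]

end GaussianBeam.KerrNullGeodesic

/-- **Elementary choice of a large parameter**: for `g₀ > 0` and any `K', E`, there is `λ ≥ 1`
with `g₀ √λ − K' ≥ E`. [folklore] -/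
theorem exists_lam_large {g₀ : ℝ} (hg₀ : 0 < g₀) (K' E : ℝ) :
    ∃ lam : ℝ, 1 ≤ lam ∧ E ≤ g₀ * √lam - K' := by
  set R : ℝ := max 1 (((E + K') / g₀) ^ 2) with hR
  refine ⟨R, le_max_left _ _, ?_⟩
  have h1 : (E + K') / g₀ ≤ √R := by
    rcases le_or_gt 0 ((E + K') / g₀) with h | h
    · calc (E + K') / g₀ = √(((E + K') / g₀) ^ 2) := (Real.sqrt_sq h).symm
        _ ≤ √R := Real.sqrt_le_sqrt (le_max_right _ _)
    · exact h.le.trans (Real.sqrt_nonneg _)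
  have h2 : E + K' ≤ g₀ * √R := by rwa [div_le_iff₀ hg₀, mul_comm] at h1
  linarith

/-- **Sbierski's characterisation of the energy of Gaussian beams along a null geodesic, on the
Kerr exterior** (Anal. PDE 8 (2015), Thm. 1.2/§4 with the third remark, for the leaves
`{t* = τ}`, `N = −(dt*)♯`, in the vendored form `KerrNullGeodesicGaussianBeams`): proved from the
explicit coordinate Gaussian beams of the series `GaussianBeam*.lean` and the beam data of the
geodesic. [cite: Sbierski2015, §4 (theorem; third remark) with §3 (second lemma; Def. 3.1) and §2 (proof of Thm. 2.1)] -/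
theorem KerrNullGeodesicGaussianBeams_holds : KerrNullGeodesicGaussianBeams := by
  intro _ _ M a hM ha haM γ hγ hnull htime h0 hmono 𝒩 h𝒩 hγ𝒩 T hT hsT μ hμ
  -- the beam data of the geodesic
  set Γ : GaussianBeam.KerrNullGeodesic M a :=
    { γ := γ, geod := hγ, null := hnull, time_pos := fun s ↦ htime s, time_zero := h0 } with hΓ
  set D := Γ.beamData with hD
  have hTJ : T ∈ Γ.J := by obtain ⟨s, -, hs⟩ := hsT; exact ⟨s, hs⟩
  have h0J : (0 : ℝ) ∈ Γ.J := Γ.zero_mem_J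
  have hIccJ : Icc (0 : ℝ) T ⊆ Γ.J := fun t ht ↦ Γ.ordConnected_J.out h0J hTJ ht
  -- the open set of the chart corresponding to `𝒩`
  obtain ⟨O, hO, hO𝒩⟩ := isOpen_induced_iff.1 h𝒩
  -- the margin `η`: `[−3η, T+3η] ⊆ J` and `X([−3η, T+3η]) ⊆ O`
  obtain ⟨η, hη, hηJ, hηO⟩ : ∃ η : ℝ, 0 < η ∧ Icc (-(3 * η)) (T + 3 * η) ⊆ Γ.J ∧
      ∀ t ∈ Icc (-(3 * η)) (T + 3 * η), D.X t ∈ O := by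
    obtain ⟨ε₁, hε₁, hb₁⟩ := Metric.mem_nhds_iff.1 (Γ.isOpen_J.mem_nhds h0J)
    obtain ⟨ε₂, hε₂, hb₂⟩ := Metric.mem_nhds_iff.1 (Γ.isOpen_J.mem_nhds hTJ)
    rw [Real.ball_eq_Ioo] at hb₁ hb₂
    have hX0 : D.X 0 ∈ O := by
      rw [hD, Γ.beamData_X h0J, Γ.σ_zero]
      have : Γ.γ 0 ∈ 𝒩 := hγ𝒩 ⟨0, Set.mem_Ici.2 le_rfl, rfl⟩
      rw [← hO𝒩] at this
      exact this
    have hXc : ContinuousAt D.X 0 := D.contDiffOn_X.continuousOn.continuousAt (Γ.isOpen_J.mem_nhds h0J)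
    obtain ⟨ε₃, hε₃, hb₃⟩ := Metric.mem_nhds_iff.1 (hXc.preimage_mem_nhds (hO.mem_nhds hX0))
    rw [Real.ball_eq_Ioo] at hb₃
    set η : ℝ := min (min ε₁ ε₂) ε₃ / 4 with hηdef
    have hηpos : 0 < η := by positivity
    have hη1 : 4 * η ≤ ε₁ := by
      have : min (min ε₁ ε₂) ε₃ ≤ ε₁ := (min_le_left _ _).trans (min_le_left _ _)
      linarith
    have hη2 : 4 * η ≤ ε₂ := by
      have : min (min ε₁ ε₂) ε₃ ≤ ε₂ := (min_le_left _ _).trans (min_le_right _ _)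
      linarith
    have hη3 : 4 * η ≤ ε₃ := by
      have : min (min ε₁ ε₂) ε₃ ≤ ε₃ := min_le_right _ _
      linarith
    have hJmem : ∀ t ∈ Icc (-(3 * η)) (T + 3 * η), t ∈ Γ.J := by
      intro t ht
      rcases lt_or_ge t 0 with h | h
      · exact hb₁ ⟨by linarith [ht.1], by linarith⟩
      · rcases le_or_gt t T with h' | h'
        · exact hIccJ ⟨h, h'⟩
        · exact hb₂ ⟨by linarith, by linarith [ht.2]⟩
    refine ⟨η, hηpos, hJmem, fun t ht ↦ ?_⟩
    rcases lt_or_ge t 0 with h | h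
    · exact hb₃ ⟨by linarith [ht.1], by linarith⟩
    · have htJ : t ∈ Γ.J := hJmem t ht
      rw [hD, Γ.beamData_X htJ]
      have : Γ.γ (Γ.σ t) ∈ 𝒩 := hγ𝒩 (Γ.X_mem_image htJ h)
      rw [← hO𝒩] at this
      exact this
  -- the range of `κ` on `[0, T]`
  have hκc : ContinuousOn D.κ (Icc (0 : ℝ) T) := D.hκ.continuousOn.mono hIccJ
  obtain ⟨tmax, htmax, hmax⟩ := isCompact_Icc.exists_isMaxOn (nonempty_Icc.2 hT.le) hκc
  obtain ⟨tmin, htmin, hmin⟩ := isCompact_Icc.exists_isMinOn (nonempty_Icc.2 hT.le) hκc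
  have hκ0 : 0 < D.κ 0 := D.hκpos 0 h0J
  have hκmin : 0 < D.κ tmin := D.hκpos tmin (hIccJ htmin)
  have hκmaxv : ∀ τ ∈ Icc (0 : ℝ) T, D.κ τ ≤ D.κ tmax := fun τ hτ ↦ hmax hτ
  have hκminv : ∀ τ ∈ Icc (0 : ℝ) T, D.κ tmin ≤ D.κ τ := fun τ hτ ↦ hmin hτ
  have hκmax0 : 0 < D.κ tmax := hκ0.trans_le (hκmaxv 0 ⟨le_rfl, hT.le⟩)
  set C₁ : ℝ := 2 * (1 + D.κ tmax / D.κ 0) / D.κ 0 with hC₁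
  have hC₁ : 0 < C₁ := by positivity
  -- the thinness `δ`
  set δ : ℝ := min (D.κ tmin / 2) (μ / (4 * D.κ 0 * C₁)) with hδdef
  have hδ : 0 < δ := by positivity
  have hδκ : ∀ τ ∈ Icc (0 : ℝ) T, 2 * δ ≤ D.κ τ := fun τ hτ ↦ by
    have : δ ≤ D.κ tmin / 2 := min_le_left _ _
    linarith [hκminv τ hτ]
  have hδμ : D.κ 0 * C₁ * δ ≤ μ / 4 := by
    have : δ ≤ μ / (4 * D.κ 0 * C₁) := min_le_right _ _
    rw [le_div_iff₀ (by positivity)] at this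
    linarith
  -- the admissible amplitude in the tube inside `O ∩ {r > r₊}`
  obtain ⟨A, hAW, hAδ, Z, Zb, hZb, hZ⟩ := D.exists_beamAmp hT.le hη hηJ (hO.inter D.hV)
    (fun t ht ↦ ⟨hηO t ht, D.hXV t (hηJ ht)⟩) hδ
  -- the energy characterisation and the slab bound
  obtain ⟨Cb, g₀, K', hCb, hg₀, hK', hchar⟩ :=
    A.energy_characterisation' hδ.le hδκ hκmaxv hAδ Z hZb hZ
  obtain ⟨Cw, hCw0, hCw⟩ := A.exists_slab_sq_waveOperator_le
  -- the parameter `λ`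
  set Eneed : ℝ := max (4 * D.κ 0 * Cb / μ) (D.κ 0 * Cw / μ) + 1 with hEneed
  obtain ⟨lam, hlam, hlamE⟩ := exists_lam_large hg₀ K' Eneed
  set E0 : ℝ := A.energy lam 0 with hE0def
  have hE0 : Eneed ≤ E0 := hlamE.trans (hchar lam hlam).1
  have hE0a : 4 * D.κ 0 * Cb / μ ≤ E0 := ((le_max_left _ _).trans (le_add_of_nonneg_right zero_le_one)).trans hE0
  have hE0b : D.κ 0 * Cw / μ ≤ E0 := ((le_max_right _ _).trans (le_add_of_nonneg_right zero_le_one)).trans hE0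
  have hE0pos : 0 < E0 := by
    have : 0 ≤ max (4 * D.κ 0 * Cb / μ) (D.κ 0 * Cw / μ) := le_max_of_le_left (by positivity)
    linarith
  -- the normalised real beam
  set sc : ℝ := √(D.κ 0 / E0) with hsc
  have hsc2 : sc ^ 2 = D.κ 0 / E0 := Real.sq_sqrt (by positivity)
  set ub : E4 → ℝ := fun x ↦ sc * A.beam lam x with hub
  have hub_smooth : ContDiff ℝ ∞ ub := contDiff_const.mul (A.contDiff_beam lam)
  have hub_zero : ∀ x, x ∉ tsupport (A.beam lam) → ub x = 0 := fun x hx ↦ by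
    simp [hub, image_eq_zero_of_notMem_tsupport hx]
  have hub_tsupp : tsupport ub ⊆ tsupport (A.beam lam) :=
    closure_minimal (fun x hx ↦ by by_contra h; exact hx (hub_zero x h)) (isClosed_tsupport _)
  have hub_c : HasCompactSupport ub :=
    IsCompact.of_isClosed_subset (A.hasCompactSupport_beam lam) (isClosed_tsupport _) hub_tsupp
  have hub_W : tsupport ub ⊆ O ∩ (Kerr.exterior M a : Set E4) :=
    hub_tsupp.trans ((A.tsupport_beam_subset lam).trans hAW)
  have hub_ext : tsupport ub ⊆ (Kerr.exterior M a : Set E4) := fun x hx ↦ (hub_W hx).2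
  set u : Kerr.exterior M a → ℝ := fun x ↦ ub x with hu
  -- the energies of `u`
  have hflux : ∀ τ, Kerr.leafFlux M a 0 u τ = ENNReal.ofReal (sc ^ 2 * A.energy lam τ) := by
    intro τ
    rw [show Kerr.leafFlux M a 0 u τ =
      Kerr.leafFlux M a 0 (fun x : Kerr.region a (Kerr.rPlus M a) ↦ ub x) τ from rfl,
      Kerr.leafFlux_zero_eq_ofReal_integral hM.le hub_smooth hub_c hub_ext τ]
    congr 1
    have hnc : ∀ y, normalCurrent (Kerr.inverseMetric M a) ub (E4.ofTimeSpace τ y) 0 =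
        sc ^ 2 * normalCurrent (Kerr.inverseMetric M a) (A.beam lam) (E4.ofTimeSpace τ y) 0 := fun y ↦
      normalCurrent_const_mul ((A.contDiff_beam lam).differentiable (by simp)) sc _ 0
    simp_rw [hnc]
    rw [integral_const_mul]
    rfl
  have hflux_nonneg : ∀ τ, 0 ≤ sc ^ 2 * A.energy lam τ := by
    intro τ
    have h : 0 ≤ ∫ y, normalCurrent (Kerr.inverseMetric M a) ub (E4.ofTimeSpace τ y) 0 :=
      integral_nonneg fun y ↦ Kerr.normalCurrent_nonneg hM.le hub_smooth hub_ext _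
    have hnc : ∀ y, normalCurrent (Kerr.inverseMetric M a) ub (E4.ofTimeSpace τ y) 0 =
        sc ^ 2 * normalCurrent (Kerr.inverseMetric M a) (A.beam lam) (E4.ofTimeSpace τ y) 0 := fun y ↦
      normalCurrent_const_mul ((A.contDiff_beam lam).differentiable (by simp)) sc _ 0
    simp_rw [hnc] at h
    rw [integral_const_mul] at h
    exact h
  refine ⟨𝒩, h𝒩, hγ𝒩, subset_rfl, u, ?_, ?_, ?_, ?_, ?_⟩
  · -- smoothness on the chart
    intro x
    exact (OpensChart.contMDiffAt_iff x u ub (fun _ ↦ rfl)).2 hub_smooth.contDiffAt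
  · -- support in `𝒩`
    intro x hx
    by_contra h
    have hmem : (x : E4) ∈ tsupport ub := subset_tsupport _ (by simpa [hu] using h)
    have : (x : E4) ∈ O := (hub_W hmem).1
    exact hx (by rw [← hO𝒩]; exact this)
  · -- the slab bound
    refine Kerr.slabSqNorm_dalembertian_le hub_smooth hub_c hub_ext ?_
    have h := A.setIntegral_sq_waveOperator_const_mul_beam_le hCw hlam sc
    refine h.trans ?_
    rw [hsc2, div_mul_eq_mul_div, div_le_iff₀ hE0pos]
    have := hE0b
    rw [div_le_iff₀ hμ] at this
    linarith
  · -- the initial energy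
    rw [hflux 0, hsc2, ← hE0def, div_mul_cancel₀ _ hE0pos.ne']
    congr 1
    show D.κ 0 = vel γ 0 0
    rw [hD]
    show Γ.κ 0 = vel γ 0 0
    rw [GaussianBeam.KerrNullGeodesic.κ, Γ.σ_zero]
  · -- the later energies
    intro τ hτ0 hτT s _ hs
    have hτ : τ ∈ Icc (0 : ℝ) T := ⟨hτ0, hτT⟩
    refine ⟨by rw [hflux τ]; exact ENNReal.ofReal_ne_top, ?_⟩
    rw [hflux τ, ENNReal.toReal_ofReal (hflux_nonneg τ)]
    have hκτ : E4.time (velocity 𝓘(ℝ, E4) γ s) = D.κ τ := by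
      rw [hD]
      show vel γ s 0 = Γ.κ τ
      exact (Γ.κ_eq_of_tfun_eq hs).symm
    rw [hκτ, hsc2]
    have hest := (hchar lam hlam).2 τ hτ
    rw [← hE0def] at hest
    -- `(κ0/E0)(E(τ) − (κτ/κ0)E0) = (κ0/E0)E(τ) − κτ`
    have hid : D.κ 0 / E0 * A.energy lam τ - D.κ τ =
        D.κ 0 / E0 * (A.energy lam τ - D.κ τ / D.κ 0 * E0) := by
      field_simp
    rw [hid, abs_mul, abs_of_pos (by positivity : 0 < D.κ 0 / E0)]
    have hb1 : D.κ 0 / E0 * (C₁ * δ * E0) = D.κ 0 * C₁ * δ := by field_simp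
    have hb2 : D.κ 0 / E0 * Cb ≤ μ / 4 := by
      rw [div_mul_eq_mul_div, div_le_iff₀ hE0pos]
      have := hE0a
      rw [div_le_iff₀ hμ] at this
      linarith
    calc D.κ 0 / E0 * |A.energy lam τ - D.κ τ / D.κ 0 * E0|
        ≤ D.κ 0 / E0 * (C₁ * δ * E0 + Cb) := mul_le_mul_of_nonneg_left hest (by positivity)
      _ = D.κ 0 * C₁ * δ + D.κ 0 / E0 * Cb := by rw [mul_add, hb1]
      _ ≤ μ / 4 + μ / 4 := add_le_add hδμ hb2
      _ < μ := by linarith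

/-- **Sbierski's Kerr trapping barrier in the literal `LED` form, modulo the Cauchy problem**:
with the Gaussian-beam fact discharged, `SbierskiKerrTrappingLED` follows from the well-posedness
of the Cauchy problem for `□_g` on the surgered Kerr–Schild background alone
(`SbierskiKerrTrappingLED.of_waveCauchyProblem_of_nullGeodesicBeams`, `TrappingDerivativeLossOrbit.lean`).
[cite: Sbierski2015, Thm. 7.4 with §4 and Thm. 5.5] -/
theorem SbierskiKerrTrappingLED.of_waveCauchyProblem (hA : KerrSchild.waveCauchyProblem) :
    SbierskiKerrTrappingLED :=
  SbierskiKerrTrappingLED.of_waveCauchyProblem_of_nullGeodesicBeams hA KerrNullGeodesicGaussianBeams_holds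

/-! ## Appendix: the discharge of `SbierskiKerrTrappingLED` -/

/-- **Sbierski's Kerr trapping theorem** (Anal. PDE 8 (2015), Thm. 7.4, print-literal `LED` form;
discharge of the named fact `SbierskiKerrTrappingLED` of `TrappingDerivativeLoss.lean`): for
`0 < M`, `0 ≤ a ≤ M` there is `R₀` such that for every coordinate ball of radius `R ≥ R₀` (these
contain the trapped null geodesics of §7A) and every `P : ℝ → (0, ∞)` with `P(τ) → 0`, the local
energy decay estimate `localSliceEnergy ψ τ R ≤ P(τ) · sliceEnergy ψ 0` (`τ ≥ 0`; the `J^N`-energies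
through the leaves `Σ_τ = {t* = τ}`, `N = −(dt*)♯`) fails for some `C^∞` function `ψ` on the Kerr
exterior solving `□_{g_{M,a}} ψ = 0` on `{t* > 0}`.
Proof: `SbierskiKerrTrappingLED.of_waveCauchyProblem` (the printed proof: Thm. 5.5 from the
Gaussian beams of Thms. 2.1/4.1/5.1 along the trapped null geodesics of §7A, all proved in this
series) applied to the theorem `KerrSchild.waveCauchyProblem_holds` (the global Cauchy problem for
`□_g` on Kerr–Schild backgrounds: John's reduction and Friedrichs' existence theorem).
[cite: Sbierski2015, Thm. 7.4 (with Thms. 2.1, 4.1, 5.1, 5.5 and §7A)] -/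
theorem SbierskiKerrTrappingLED_holds : SbierskiKerrTrappingLED :=
  SbierskiKerrTrappingLED.of_waveCauchyProblem KerrSchild.waveCauchyProblem_holds

end Literature.Barriers.FinalStateConjecture
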